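/- EXTRA WIDTH seat `ym-line-cbag-p1-w5` (prover-ym-line-cbag-p1-w5-g17-0), LINE 7b `VolumeComparison` of route `GlueballBandRecursion`,
item ⟨stmt-QuantumFields-22957⟩ (`--supports`, helper; it closes nothing).  Piece C3 (support lifting), sequel of `…KeptSupportLifting.lean`
for the SINGLETON-FREE kept family «closed, connected, `#A ≤ 4k`» used by width seat w4's `Thermal.norm_tubeLogZ_div_sub_le_of_kept_eq`:
factor of the volume, lifting across spatial volumes, and the per-site identity in exactly w4's `hlift` shape.  Definition-free. -/
import Summits.QuantumFields.YangMills.Theorems.GlueballBandRecursionKeptSupportLifting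

/-!
# Route `GlueballBandRecursion`, LINE 7b: lifting of the singleton-free kept support sums (piece C3, sequel)

Notation as in `…SupportExpansion` / `…SupportLifting` / `…KeptSupportLifting` (always written out): `ψ_n(A)(z)` is the support sum of the
label set `A` for `boxSystem ρ n` at complex coupling `z`; CLOSED `A` := `∀ p ∈ A, ∀ e ∈ p.bonds, ∃ q ∈ A, q ≠ p ∧ e ∈ q.bonds`; CONNECTED :=
`IsRConnected (boxSystem ρ n).Adj A`.

* `closedKept_image_rot_iff`, **`closedKept_sum_eq_prod_mul_sum_rooted`** (`Σ_{closed, conn, #≤4k} ψ_n = (∏_{i∈J} nᵢ) · Σ_{J-small, same, rooted in J} ψ_n`,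
  all sides `≥ 4`, `k < nᵢ` on `J`), **`rooted_closedKept_sum_eq_of_le`** (nested boxes agreeing outside `J`, `k + 1 ≤ nᵢ` on `J`);
* tubes: `closedKept_sum_tube_eq_cube_mul`, `rooted_closedKept_sum_tube_eq`, **`closedKept_sum_tube_mul_eq`** and
  **`closedKept_sum_tube_div_eq`** — for `4 ≤ a ≤ a'`, `4 ≤ T`, every complex `z`:
  `(Σ_{closed, conn, #≤4(a−1)} ψ_{![a',a',a',T]})/a'³ = (Σ_{closed, conn, #≤4(a−1)} ψ_{![a,a,a,T]})/a³` — the hypothesis `hlift` of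
  `Thermal.norm_tubeLogZ_div_sub_le_of_kept_eq` (`…VolumeJetsOfSupport.lean`), verbatim (`4 ≤ T` is necessary: w2 g23's time-wrapping sheets at
  `T = 2`).

HONEST FRAMING.  Finite combinatorics; a step toward the ∃-window strong-coupling RECORD rung `ColdDoublingRecursionSmallCoupling` via the LEAD's /
w4's jet assembly; item 22957, the typed-window rung `ColdDoublingRecursionStrongCoupling` and the Yang–Mills mass gap / the summit `YangMills`
are NOT proved or advanced here.
-/

set_option autoImplicit false

noncomputable section

open MeasureTheory Finset
open Literature.Probability.LatticeModels
open Literature.MathematicalPhysics.QuantumFieldTheory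

namespace Summit.QuantumFields.YangMills.Theorems.GlueballBandRecursion.SupportLifting

variable {d : ℕ} {n n' : Fin d → ℕ} {G : Type*} [Group G] {N : ℕ} {ρ : G →* Matrix (Fin N) (Fin N) ℂ}
  [TopologicalSpace G] [IsTopologicalGroup G] [CompactSpace G] [MeasurableSpace G] [BorelSpace G]

/-! ## The singleton-free kept family — w4's `hlift` verbatim

Width seat w4 g13's `Thermal.norm_tubeLogZ_div_sub_le_of_kept_eq` (`…VolumeJetsOfSupport.lean`, 2026-08-28T20:57Z) separates the singletons
(`#W · log c(z)`, `Support.sum_support_card_eq_one`) and keeps «closed, connected, `#A ≤ 4(a−1)`» WITHOUT the `#A = 1` disjunct, in DIVISION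
form.  The same rooting / free action / translation invariance / inclusion apply to that family (a sub-family of §1's); here is its factor of
the volume, its lifting, and the identity in exactly w4's shape (`closedKept_sum_tube_div_eq`), for `4 ≤ a ≤ a'`, `4 ≤ T` (w2 g23's check
20:58Z: `4 ≤ T` is needed — at `T = 2` the time-wrapping sheets of `2a` plaquettes are closed, connected, kept and unliftable). -/

omit [TopologicalSpace G] [IsTopologicalGroup G] [CompactSpace G] [MeasurableSpace G] [BorelSpace G] in
/-- The singleton-free kept family «closed, connected, `#A ≤ 4k`» is translation invariant. -/
theorem closedKept_image_rot_iff (i : Fin d) (s k : ℕ) (A : Finset (BoxLabel n)) :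
    ((∀ p ∈ A.image (BoxLabel.rot i s), ∀ e ∈ p.bonds, ∃ q ∈ A.image (BoxLabel.rot i s), q ≠ p ∧ e ∈ q.bonds) ∧
        IsRConnected (boxSystem (G := G) ρ n).Adj (A.image (BoxLabel.rot i s)) ∧ (A.image (BoxLabel.rot i s)).card ≤ 4 * k) ↔
      ((∀ p ∈ A, ∀ e ∈ p.bonds, ∃ q ∈ A, q ≠ p ∧ e ∈ q.bonds) ∧ IsRConnected (boxSystem (G := G) ρ n).Adj A ∧ A.card ≤ 4 * k) := by
  rw [Finset.card_image_of_injective _ (BoxLabel.rot_injective i s), SlabCount.closed_image_rot_iff,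
    isRConnected_rot_iff (G := G) (ρ := ρ)]

open scoped Classical in
/-- **The singleton-free kept support sum is `∏_{i∈J} nᵢ` times a rooted sum** (all sides `≥ 4`, `k < nᵢ` on `J`; every `z`). -/
theorem closedKept_sum_eq_prod_mul_sum_rooted (hρ : Continuous ρ) (hn : ∀ j, 4 ≤ n j) (J : Finset (Fin d)) {k : ℕ}
    (hk : ∀ i ∈ J, k < n i) (z : ℂ) :
    ∑ A ∈ (Finset.univ : Finset (BoxLabel n)).powerset with
        ((∀ p ∈ A, ∀ e ∈ p.bonds, ∃ q ∈ A, q ≠ p ∧ e ∈ q.bonds) ∧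
          IsRConnected (boxSystem (G := G) ρ n).Adj A ∧ A.card ≤ 4 * k),
        ∑ 𝒞 ∈ (rconnSubsets (boxSystem (G := G) ρ n).Adj A).powerset with 𝒞.biUnion id = A,
          truncatedWeight (GeomInc (boxSystem (G := G) ρ n).Adj)
            (connActivity (boxSystem (G := G) ρ n).Adj (zdHaar d G) ((boxSystem (G := G) ρ n).weight z)) 𝒞 =
      (∏ i ∈ J, (n i : ℂ)) * ∑ A ∈ (Finset.univ : Finset (BoxLabel n)).powerset with
          ((∀ p ∈ A, ∀ j ∈ J, BoxLabel.coord j p < k) ∧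
            (((∀ p ∈ A, ∀ e ∈ p.bonds, ∃ q ∈ A, q ≠ p ∧ e ∈ q.bonds) ∧
              IsRConnected (boxSystem (G := G) ρ n).Adj A ∧ A.card ≤ 4 * k) ∧
              ∀ j ∈ J, ∃ p ∈ A, BoxLabel.coord j p = 0)),
        ∑ 𝒞 ∈ (rconnSubsets (boxSystem (G := G) ρ n).Adj A).powerset with 𝒞.biUnion id = A,
          truncatedWeight (GeomInc (boxSystem (G := G) ρ n).Adj)
            (connActivity (boxSystem (G := G) ρ n).Adj (zdHaar d G) ((boxSystem (G := G) ρ n).weight z)) 𝒞 := by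
  refine sum_support_eq_prod_mul_sum_of_iff (G := G) (ρ := ρ) hρ J k _
    (fun i _ s A => closedKept_image_rot_iff (G := G) (ρ := ρ) i s k A)
    (fun i hi A hA => SlabCount.exists_rooting_of_closed (G := G) (ρ := ρ) hn hA.1 hA.2.1 i (hk i hi) hA.2.2)
    (fun i hi A hA hlt h0 s hs hlt' h0' => rooting_free_of_kept (G := G) (ρ := ρ) hn i (hk i hi) (Or.inr hA) hlt h0 hs hlt' h0') _
    (fun A => ?_) z
  constructor
  · rintro ⟨hsmall, hkept, hroot⟩
    exact ⟨hkept, fun j hj => ⟨fun p hp => hsmall p hp j hj, hroot j hj⟩⟩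
  · rintro ⟨hkept, hroot⟩
    exact ⟨fun p hp j hj => (hroot j hj).1 p hp, hkept, fun j hj => (hroot j hj).2⟩

open scoped Classical in
/-- **The rooted singleton-free kept sums of nested boxes agree** (sizes `n ≤ n'` agreeing outside `J`, `k + 1 ≤ nᵢ` on `J`, all `nᵢ > 0`). -/
theorem rooted_closedKept_sum_eq_of_le (hρ : Continuous ρ) (h : ∀ i, n i ≤ n' i) (J : Finset (Fin d))
    (hJ : ∀ i, i ∉ J → n i = n' i) {k : ℕ} (hk : ∀ i ∈ J, k + 1 ≤ n i) (hpos : ∀ i, 0 < n i) (z : ℂ) :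
    ∑ A' ∈ (Finset.univ : Finset (BoxLabel n')).powerset with
        ((∀ p' ∈ A', ∀ j ∈ J, BoxLabel.coord j p' < k) ∧
          (((∀ p' ∈ A', ∀ e ∈ p'.bonds, ∃ q' ∈ A', q' ≠ p' ∧ e ∈ q'.bonds) ∧
            IsRConnected (boxSystem (G := G) ρ n').Adj A' ∧ A'.card ≤ 4 * k) ∧
            ∀ j ∈ J, ∃ p' ∈ A', BoxLabel.coord j p' = 0)),
        ∑ 𝒞 ∈ (rconnSubsets (boxSystem (G := G) ρ n').Adj A').powerset with 𝒞.biUnion id = A',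
          truncatedWeight (GeomInc (boxSystem (G := G) ρ n').Adj)
            (connActivity (boxSystem (G := G) ρ n').Adj (zdHaar d G) ((boxSystem (G := G) ρ n').weight z)) 𝒞 =
      ∑ A ∈ (Finset.univ : Finset (BoxLabel n)).powerset with
        ((∀ p ∈ A, ∀ j ∈ J, BoxLabel.coord j p < k) ∧
          (((∀ p ∈ A, ∀ e ∈ p.bonds, ∃ q ∈ A, q ≠ p ∧ e ∈ q.bonds) ∧
            IsRConnected (boxSystem (G := G) ρ n).Adj A ∧ A.card ≤ 4 * k) ∧
            ∀ j ∈ J, ∃ p ∈ A, BoxLabel.coord j p = 0)),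
        ∑ 𝒞 ∈ (rconnSubsets (boxSystem (G := G) ρ n).Adj A).powerset with 𝒞.biUnion id = A,
          truncatedWeight (GeomInc (boxSystem (G := G) ρ n).Adj)
            (connActivity (boxSystem (G := G) ρ n).Adj (zdHaar d G) ((boxSystem (G := G) ρ n).weight z)) 𝒞 := by
  refine BoxSupport.sum_support_sum_eq_of_le_of_iff (G := G) ρ hρ h J hJ hk hpos _ _ (fun A hA => ?_) z
  rw [BoxSupport.card_image_castLE, BoxSupport.closed_image_castLE_iff h hJ hk hA,
    BoxSupport.isRConnected_image_castLE_iff (G := G) ρ h hJ hk hA]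
  simp only [Finset.mem_image, exists_exists_and_eq_and, BoxSupport.coord_castLE]

open scoped Classical in
/-- **The singleton-free kept support sum of the tube `b³ × T` is `b³` times its rooted sum** (`k < b`, `4 ≤ b`, `4 ≤ T`). -/
theorem closedKept_sum_tube_eq_cube_mul (hρ : Continuous ρ) {b T k : ℕ} (hb : 4 ≤ b) (hT : 4 ≤ T) (hkb : k < b) (z : ℂ) :
    ∑ A ∈ (Finset.univ : Finset (BoxLabel (![b, b, b, T] : Fin 4 → ℕ))).powerset with
        ((∀ p ∈ A, ∀ e ∈ p.bonds, ∃ q ∈ A, q ≠ p ∧ e ∈ q.bonds) ∧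
          IsRConnected (boxSystem (G := G) ρ (![b, b, b, T] : Fin 4 → ℕ)).Adj A ∧ A.card ≤ 4 * k),
        ∑ 𝒞 ∈ (rconnSubsets (boxSystem (G := G) ρ (![b, b, b, T] : Fin 4 → ℕ)).Adj A).powerset with 𝒞.biUnion id = A,
          truncatedWeight (GeomInc (boxSystem (G := G) ρ (![b, b, b, T] : Fin 4 → ℕ)).Adj)
            (connActivity (boxSystem (G := G) ρ (![b, b, b, T] : Fin 4 → ℕ)).Adj (zdHaar 4 G)
              ((boxSystem (G := G) ρ (![b, b, b, T] : Fin 4 → ℕ)).weight z)) 𝒞 =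
      (b : ℂ) ^ 3 * ∑ A ∈ (Finset.univ : Finset (BoxLabel (![b, b, b, T] : Fin 4 → ℕ))).powerset with
          ((∀ p ∈ A, ∀ j ∈ ({0, 1, 2} : Finset (Fin 4)), BoxLabel.coord j p < k) ∧
            (((∀ p ∈ A, ∀ e ∈ p.bonds, ∃ q ∈ A, q ≠ p ∧ e ∈ q.bonds) ∧
              IsRConnected (boxSystem (G := G) ρ (![b, b, b, T] : Fin 4 → ℕ)).Adj A ∧ A.card ≤ 4 * k) ∧
              ∀ j ∈ ({0, 1, 2} : Finset (Fin 4)), ∃ p ∈ A, BoxLabel.coord j p = 0)),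
        ∑ 𝒞 ∈ (rconnSubsets (boxSystem (G := G) ρ (![b, b, b, T] : Fin 4 → ℕ)).Adj A).powerset with 𝒞.biUnion id = A,
          truncatedWeight (GeomInc (boxSystem (G := G) ρ (![b, b, b, T] : Fin 4 → ℕ)).Adj)
            (connActivity (boxSystem (G := G) ρ (![b, b, b, T] : Fin 4 → ℕ)).Adj (zdHaar 4 G)
              ((boxSystem (G := G) ρ (![b, b, b, T] : Fin 4 → ℕ)).weight z)) 𝒞 := by
  have h := closedKept_sum_eq_prod_mul_sum_rooted (G := G) (ρ := ρ) (n := (![b, b, b, T] : Fin 4 → ℕ)) hρ (tube_four_le hb hT)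
    ({0, 1, 2} : Finset (Fin 4)) (k := k) (fun i hi => by rw [tube_spatial_apply i hi]; exact hkb) z
  rw [prod_tube_spatial] at h
  refine (sum_filter_congr_prop (fun _ _ => Iff.rfl) _).trans (h.trans ?_)
  exact congrArg (fun x : ℂ => (b : ℂ) ^ 3 * x) (sum_filter_congr_prop (fun _ _ => Iff.rfl) _)

open scoped Classical in
/-- **The rooted singleton-free kept sums of the tubes `a³ × T ⊆ a'³ × T` agree** (`k + 1 ≤ a ≤ a'`, `0 < a`, `0 < T`). -/
theorem rooted_closedKept_sum_tube_eq (hρ : Continuous ρ) {a a' T k : ℕ} (haa' : a ≤ a') (hka : k + 1 ≤ a) (ha : 0 < a)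
    (hT : 0 < T) (z : ℂ) :
    ∑ A' ∈ (Finset.univ : Finset (BoxLabel (![a', a', a', T] : Fin 4 → ℕ))).powerset with
        ((∀ p' ∈ A', ∀ j ∈ ({0, 1, 2} : Finset (Fin 4)), BoxLabel.coord j p' < k) ∧
          (((∀ p' ∈ A', ∀ e ∈ p'.bonds, ∃ q' ∈ A', q' ≠ p' ∧ e ∈ q'.bonds) ∧
            IsRConnected (boxSystem (G := G) ρ (![a', a', a', T] : Fin 4 → ℕ)).Adj A' ∧ A'.card ≤ 4 * k) ∧
            ∀ j ∈ ({0, 1, 2} : Finset (Fin 4)), ∃ p' ∈ A', BoxLabel.coord j p' = 0)),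
        ∑ 𝒞 ∈ (rconnSubsets (boxSystem (G := G) ρ (![a', a', a', T] : Fin 4 → ℕ)).Adj A').powerset with 𝒞.biUnion id = A',
          truncatedWeight (GeomInc (boxSystem (G := G) ρ (![a', a', a', T] : Fin 4 → ℕ)).Adj)
            (connActivity (boxSystem (G := G) ρ (![a', a', a', T] : Fin 4 → ℕ)).Adj (zdHaar 4 G)
              ((boxSystem (G := G) ρ (![a', a', a', T] : Fin 4 → ℕ)).weight z)) 𝒞 =
      ∑ A ∈ (Finset.univ : Finset (BoxLabel (![a, a, a, T] : Fin 4 → ℕ))).powerset with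
        ((∀ p ∈ A, ∀ j ∈ ({0, 1, 2} : Finset (Fin 4)), BoxLabel.coord j p < k) ∧
          (((∀ p ∈ A, ∀ e ∈ p.bonds, ∃ q ∈ A, q ≠ p ∧ e ∈ q.bonds) ∧
            IsRConnected (boxSystem (G := G) ρ (![a, a, a, T] : Fin 4 → ℕ)).Adj A ∧ A.card ≤ 4 * k) ∧
            ∀ j ∈ ({0, 1, 2} : Finset (Fin 4)), ∃ p ∈ A, BoxLabel.coord j p = 0)),
        ∑ 𝒞 ∈ (rconnSubsets (boxSystem (G := G) ρ (![a, a, a, T] : Fin 4 → ℕ)).Adj A).powerset with 𝒞.biUnion id = A,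
          truncatedWeight (GeomInc (boxSystem (G := G) ρ (![a, a, a, T] : Fin 4 → ℕ)).Adj)
            (connActivity (boxSystem (G := G) ρ (![a, a, a, T] : Fin 4 → ℕ)).Adj (zdHaar 4 G)
              ((boxSystem (G := G) ρ (![a, a, a, T] : Fin 4 → ℕ)).weight z)) 𝒞 := by
  have h := rooted_closedKept_sum_eq_of_le (G := G) (ρ := ρ) (n := (![a, a, a, T] : Fin 4 → ℕ))
    (n' := (![a', a', a', T] : Fin 4 → ℕ)) hρ (tube_spatial_le haa') ({0, 1, 2} : Finset (Fin 4)) tube_spatial_eq_of_ne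
    (k := k) (fun i hi => by rw [tube_spatial_apply i hi]; exact hka) (tube_sizes_pos ha hT) z
  exact (sum_filter_congr_prop (fun _ _ => Iff.rfl) _).trans (h.trans (sum_filter_congr_prop (fun _ _ => Iff.rfl) _))

open scoped Classical in
/-- **The per-site singleton-free kept sums of the tubes agree (cross-multiplied form).**  For `4 ≤ a ≤ a'`, `4 ≤ T`, every `z`, with the
family «closed, connected, `#A ≤ 4(a−1)`» in BOTH boxes: `(Σ ψ_{![a',a',a',T]}) · a³ = (Σ ψ_{![a,a,a,T]}) · a'³`. -/
theorem closedKept_sum_tube_mul_eq (hρ : Continuous ρ) {a a' T : ℕ} (ha : 4 ≤ a) (haa' : a ≤ a') (hT : 4 ≤ T) (z : ℂ) :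
    (∑ A' ∈ (Finset.univ : Finset (BoxLabel (![a', a', a', T] : Fin 4 → ℕ))).powerset with
        ((∀ p' ∈ A', ∀ e ∈ p'.bonds, ∃ q' ∈ A', q' ≠ p' ∧ e ∈ q'.bonds) ∧
          IsRConnected (boxSystem (G := G) ρ (![a', a', a', T] : Fin 4 → ℕ)).Adj A' ∧ A'.card ≤ 4 * (a - 1)),
        ∑ 𝒞 ∈ (rconnSubsets (boxSystem (G := G) ρ (![a', a', a', T] : Fin 4 → ℕ)).Adj A').powerset with 𝒞.biUnion id = A',
          truncatedWeight (GeomInc (boxSystem (G := G) ρ (![a', a', a', T] : Fin 4 → ℕ)).Adj)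
            (connActivity (boxSystem (G := G) ρ (![a', a', a', T] : Fin 4 → ℕ)).Adj (zdHaar 4 G)
              ((boxSystem (G := G) ρ (![a', a', a', T] : Fin 4 → ℕ)).weight z)) 𝒞) * (a : ℂ) ^ 3 =
      (∑ A ∈ (Finset.univ : Finset (BoxLabel (![a, a, a, T] : Fin 4 → ℕ))).powerset with
        ((∀ p ∈ A, ∀ e ∈ p.bonds, ∃ q ∈ A, q ≠ p ∧ e ∈ q.bonds) ∧
          IsRConnected (boxSystem (G := G) ρ (![a, a, a, T] : Fin 4 → ℕ)).Adj A ∧ A.card ≤ 4 * (a - 1)),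
        ∑ 𝒞 ∈ (rconnSubsets (boxSystem (G := G) ρ (![a, a, a, T] : Fin 4 → ℕ)).Adj A).powerset with 𝒞.biUnion id = A,
          truncatedWeight (GeomInc (boxSystem (G := G) ρ (![a, a, a, T] : Fin 4 → ℕ)).Adj)
            (connActivity (boxSystem (G := G) ρ (![a, a, a, T] : Fin 4 → ℕ)).Adj (zdHaar 4 G)
              ((boxSystem (G := G) ρ (![a, a, a, T] : Fin 4 → ℕ)).weight z)) 𝒞) * (a' : ℂ) ^ 3 := by
  have hka : a - 1 < a := by omega
  have hka' : a - 1 < a' := by omega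
  rw [closedKept_sum_tube_eq_cube_mul (G := G) (ρ := ρ) hρ (le_trans ha haa') hT hka' z,
    closedKept_sum_tube_eq_cube_mul (G := G) (ρ := ρ) hρ ha hT hka z,
    rooted_closedKept_sum_tube_eq (G := G) (ρ := ρ) hρ haa' (by omega) (by omega) (by omega) z]
  ring

open scoped Classical in
/-- **w4's lifting hypothesis `hlift`, discharged**: for `4 ≤ a ≤ a'`, `4 ≤ T` and every complex `z`, the per-site sums of the support
functionals over the closed connected supports with `≤ 4(a−1)` plaquettes agree for the tubes `a'³ × T` and `a³ × T` — in the division form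
consumed by `Thermal.norm_tubeLogZ_div_sub_le_of_kept_eq` (`…VolumeJetsOfSupport.lean`). -/
theorem closedKept_sum_tube_div_eq (hρ : Continuous ρ) {a a' T : ℕ} (ha : 4 ≤ a) (haa' : a ≤ a') (hT : 4 ≤ T) (z : ℂ) :
    (∑ A ∈ (Finset.univ : Finset (BoxLabel (![a', a', a', T] : Fin 4 → ℕ))).powerset with
          ((∀ p ∈ A, ∀ e ∈ p.bonds, ∃ q ∈ A, q ≠ p ∧ e ∈ q.bonds) ∧
            IsRConnected (boxSystem (G := G) ρ (![a', a', a', T] : Fin 4 → ℕ)).Adj A ∧ A.card ≤ 4 * (a - 1)),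
        ∑ 𝒞 ∈ (rconnSubsets (boxSystem (G := G) ρ (![a', a', a', T] : Fin 4 → ℕ)).Adj A).powerset with 𝒞.biUnion id = A,
          truncatedWeight (GeomInc (boxSystem (G := G) ρ (![a', a', a', T] : Fin 4 → ℕ)).Adj)
            (connActivity (boxSystem (G := G) ρ (![a', a', a', T] : Fin 4 → ℕ)).Adj (zdHaar 4 G)
              ((boxSystem (G := G) ρ (![a', a', a', T] : Fin 4 → ℕ)).weight z)) 𝒞) / ((a' : ℂ) ^ 3) =
      (∑ A ∈ (Finset.univ : Finset (BoxLabel (![a, a, a, T] : Fin 4 → ℕ))).powerset with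
          ((∀ p ∈ A, ∀ e ∈ p.bonds, ∃ q ∈ A, q ≠ p ∧ e ∈ q.bonds) ∧
            IsRConnected (boxSystem (G := G) ρ (![a, a, a, T] : Fin 4 → ℕ)).Adj A ∧ A.card ≤ 4 * (a - 1)),
        ∑ 𝒞 ∈ (rconnSubsets (boxSystem (G := G) ρ (![a, a, a, T] : Fin 4 → ℕ)).Adj A).powerset with 𝒞.biUnion id = A,
          truncatedWeight (GeomInc (boxSystem (G := G) ρ (![a, a, a, T] : Fin 4 → ℕ)).Adj)
            (connActivity (boxSystem (G := G) ρ (![a, a, a, T] : Fin 4 → ℕ)).Adj (zdHaar 4 G)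
              ((boxSystem (G := G) ρ (![a, a, a, T] : Fin 4 → ℕ)).weight z)) 𝒞) / ((a : ℂ) ^ 3) := by
  have ha0 : (a : ℂ) ^ 3 ≠ 0 := pow_ne_zero 3 (Nat.cast_ne_zero.2 (by omega))
  have ha0' : (a' : ℂ) ^ 3 ≠ 0 := pow_ne_zero 3 (Nat.cast_ne_zero.2 (by omega))
  rw [div_eq_div_iff ha0' ha0]
  exact closedKept_sum_tube_mul_eq (G := G) (ρ := ρ) hρ ha haa' hT z

end Summit.QuantumFields.YangMills.Theorems.GlueballBandRecursion.SupportLifting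

end
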